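import Summits.MatrixMultiplication.MatrixMultiplication.Theorems.NilpotentLieHostsUnitriangularCostShapeModelSpan

/-!
# `UnitriangularCostShape` — Product model, part 10: the truncated Casimir ring, generators of `W_T`, the matrix lift

Crux `stmt-MatrixMultiplication-7724` (`NilpotentLieHosts.UnitriangularCostShape`), line `registered`
(`Cruxes/UnitriangularCostShape/Lines/birth.lean`), stub `stub_productModel` (the Weyl-type product model of
`U(u_d)/I^(s+1)` over the truncated Casimir algebra, `b = k = ⌊d/2⌋`).  Helper vocabulary and lemmas, namespace
`…Theorems.UnitriangularCostShape.ProductModel`.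

`Rt`, `psi : R_{T+1} → W_T`, the generators `wgen` indexed by `Idx d T = (q-variables → Fin (T+1))`, the
parametrisation `phi`, its surjectivity `phi_surj`, the lift `rho` of `π_T(c)` and the lift property `phi_mulVec`.
-/

set_option linter.dupNamespace false

noncomputable section

namespace Summit.MatrixMultiplication.MatrixMultiplication.Theorems.UnitriangularCostShape.ProductModel

open MvPolynomial
open scoped BigOperators

variable {d : ℕ}

/-- The corner (Casimir) variables `z_r = (r, d-1-r)`, `r < d/2`. -/
def zvar (r : Fin (d / 2)) : Var d :=
  ⟨(⟨r, by omega⟩, ⟨d - 1 - r, by omega⟩), by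
    refine ⟨?_, ?_⟩
    · show (⟨(r : ℕ), _⟩ : Fin d) < ⟨d - 1 - r, _⟩
      rw [Fin.lt_def]; simp only; omega
    · simp only; omega⟩

/-- Row of a Casimir variable. -/
@[simp] theorem zvar_row_val (r : Fin (d / 2)) : ((zvar r).row : ℕ) = r := rfl
/-- Column of a Casimir variable. -/
@[simp] theorem zvar_col_val (r : Fin (d / 2)) : ((zvar r).col : ℕ) = d - 1 - r := rfl

/-- Casimir variables are corners: `i + j + 1 = d`. -/
theorem zvar_corner (r : Fin (d / 2)) : ((zvar r).row : ℕ) + (zvar r).col + 1 = d := by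
  simp; omega

/-- The Casimir variables are distinct. -/
theorem zvar_injective : Function.Injective (zvar (d := d)) := by
  intro r r' h
  have := congrArg (fun u : Var d => (u.row : ℕ)) h
  simp at this
  exact Fin.ext this

/-- A non-`q` variable is a Casimir variable. -/
theorem exists_zvar_of_not_q {u : Var d} (hu : ¬ d ≤ (u.row : ℕ) + u.col) : ∃ r, zvar r = u := by
  have h1 := u.le_row_add_col
  have h2 : (u.row : ℕ) < u.col := u.row_lt_col
  have h3 : (u.col : ℕ) < d := u.col.2
  refine ⟨⟨u.row, by omega⟩, ?_⟩
  apply Subtype.ext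
  apply Prod.ext
  · rfl
  · apply Fin.ext
    show d - 1 - (u.row : ℕ) = u.col
    omega

/-- Casimir variables are not `q`-variables. -/
theorem not_q_zvar (r : Fin (d / 2)) : ¬ d ≤ ((zvar r).row : ℕ) + (zvar r).col := by
  simp; omega

/-- The truncated Casimir ring `R_t = ℂ[z_1..z_k]/(z_i^t)`, `k = ⌊d/2⌋`. -/
abbrev Rt (d t : ℕ) : Type :=
  MvPolynomial (Fin (d / 2)) ℂ ⧸ Ideal.span (Set.range fun i : Fin (d / 2) => (X i : MvPolynomial (Fin (d / 2)) ℂ) ^ t)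

/-- `R_{T+1} → W_T`, `z_r ↦ v_{(r, d-1-r)}`. -/
def psi (d T : ℕ) : Rt d (T + 1) →ₐ[ℂ] TruncModel d ℂ T :=
  Ideal.Quotient.liftₐ _ ((Ideal.Quotient.mkₐ ℂ (truncIdeal d ℂ T)).comp (rename zvar)) (by
    intro a ha
    rw [← RingHom.mem_ker]
    revert ha a
    apply Ideal.span_le.mpr
    rintro _ ⟨r, rfl⟩
    rw [SetLike.mem_coe, RingHom.mem_ker]
    show (Ideal.Quotient.mkₐ ℂ (truncIdeal d ℂ T)) (rename zvar ((X r : MvPolynomial (Fin (d / 2)) ℂ) ^ (T + 1))) = 0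
    rw [map_pow, rename_X, Ideal.Quotient.mkₐ_eq_mk, map_pow]
    exact pow_mk_eq_zero_of_wtGe ((wtGe_X _).mono (Var.one_le_wt _)) le_rfl)

/-- `psi` on representatives: rename along `zvar`. -/
theorem psi_mk (T : ℕ) (P : MvPolynomial (Fin (d / 2)) ℂ) :
    psi d T (Ideal.Quotient.mk _ P) = Ideal.Quotient.mk (truncIdeal d ℂ T) (rename zvar P) := rfl

/-- `σ_c` fixes the Casimir polynomials. -/
theorem sigma_rename_zvar (c : Matrix (Fin d) (Fin d) ℂ) (P : MvPolynomial (Fin (d / 2)) ℂ) :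
    sigma c (rename zvar P) = rename zvar P := by
  have : (sigma c).comp (rename zvar) = rename zvar := by
    refine MvPolynomial.algHom_ext fun r => ?_
    rw [AlgHom.comp_apply, rename_X, sigma_X, sigmaX_of_corner c _ (zvar_corner r)]
  exact AlgHom.congr_fun this P

/-- `π_T(c)` is linear over the image of `R_t`. -/
theorem piT_psi_mul (T : ℕ) (c : Matrix (Fin d) (Fin d) ℂ) (x : Rt d (T + 1)) (w : TruncModel d ℂ T) :
    piT T c (psi d T x * w) = psi d T x * piT T c w := by
  obtain ⟨P, rfl⟩ := Ideal.Quotient.mk_surjective x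
  rw [psi_mk]
  unfold piT
  rw [map_mul, sigmaQ_mk, sigma_rename_zvar]
  ring

/-! ### The index set of generators -/

/-- `q`-variables. -/
abbrev QIdx (d : ℕ) : Type := {u : Var d // d ≤ (u.row : ℕ) + u.col}

/-- Index set of the `R_t`-module generators of `W_T`: exponent vectors on the `q`-variables. -/
abbrev Idx (d T : ℕ) : Type := QIdx d → Fin (T + 1)

/-- The exponent vector of an index. -/
def toExp {T : ℕ} (a : Idx d T) : Var d →₀ ℕ :=
  Finsupp.equivFunOnFinite.symm fun u => if h : d ≤ (u.row : ℕ) + u.col then (a ⟨u, h⟩ : ℕ) else 0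

/-- Values of the exponent vector of an index. -/
@[simp] theorem toExp_apply {T : ℕ} (a : Idx d T) (u : Var d) :
    toExp a u = if h : d ≤ (u.row : ℕ) + u.col then (a ⟨u, h⟩ : ℕ) else 0 := by
  simp [toExp]

/-- The generator attached to an index: the `q`-monomial. -/
def wgen (T : ℕ) (a : Idx d T) : TruncModel d ℂ T := Ideal.Quotient.mk _ (monomial (toExp a) 1)

/-- The `R_t`-linear parametrisation `R_t^N → W_T`. -/
def phi (T : ℕ) (c : Fin (Fintype.card (Idx d T)) → Rt d (T + 1)) : TruncModel d ℂ T :=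
  ∑ a : Idx d T, psi d T (c (Fintype.equivFin (Idx d T) a)) * wgen T a

/-- `phi` is additive. -/
theorem phi_add (T : ℕ) (c c' : Fin (Fintype.card (Idx d T)) → Rt d (T + 1)) :
    phi T (c + c') = phi T c + phi T c' := by
  unfold phi
  rw [← Finset.sum_add_distrib]
  refine Finset.sum_congr rfl fun a _ => ?_
  rw [Pi.add_apply, map_add, add_mul]

/-- `phi` is `ℂ`-linear. -/
theorem phi_smul (T : ℕ) (q : ℂ) (c : Fin (Fintype.card (Idx d T)) → Rt d (T + 1)) :
    phi T (q • c) = q • phi T c := by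
  unfold phi
  rw [Finset.smul_sum]
  refine Finset.sum_congr rfl fun a _ => ?_
  rw [Pi.smul_apply, map_smul, smul_mul_assoc]

/-- `phi` on a coordinate vector. -/
theorem phi_single (T : ℕ) (a : Idx d T) (x : Rt d (T + 1)) :
    phi T (Pi.single (Fintype.equivFin (Idx d T) a) x) = psi d T x * wgen T a := by
  classical
  unfold phi
  rw [Finset.sum_eq_single a]
  · rw [Pi.single_eq_same]
  · intro b _ hb
    rw [Pi.single_eq_of_ne, map_zero, zero_mul]
    exact fun h => hb ((Fintype.equivFin (Idx d T)).injective h)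
  · intro h; exact absurd (Finset.mem_univ a) h

/-- Every element of `W_T` is an `R_t`-combination of the generators. -/
theorem phi_surj (T : ℕ) (f : MvPolynomial (Var d) ℂ) :
    ∃ c, phi T c = Ideal.Quotient.mk (truncIdeal d ℂ T) f := by
  classical
  induction f using MvPolynomial.induction_on' with
  | add f g hf hg =>
    obtain ⟨c, hc⟩ := hf
    obtain ⟨c', hc'⟩ := hg
    exact ⟨c + c', by rw [phi_add, hc, hc', map_add]⟩
  | monomial m r =>
    -- split the exponent into its `z`- and `q`-parts
    set mq : Var d →₀ ℕ := m.filter fun u => d ≤ (u.row : ℕ) + u.col with hmq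
    set mz : Fin (d / 2) →₀ ℕ := Finsupp.equivFunOnFinite.symm fun r => m (zvar r) with hmz
    have hz : mz.mapDomain zvar = m.filter fun u => ¬ d ≤ (u.row : ℕ) + u.col := by
      ext u
      rw [Finsupp.filter_apply]
      split_ifs with h
      · rw [Finsupp.mapDomain_notin_range]
        rintro ⟨r, rfl⟩
        exact not_q_zvar r h
      · obtain ⟨r, rfl⟩ := exists_zvar_of_not_q h
        rw [Finsupp.mapDomain_apply zvar_injective]
        simp [hmz]
    have hsplit : monomial m r = C r * rename zvar (monomial mz 1) * monomial mq 1 := by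
      rw [rename_monomial, hz, mul_assoc, monomial_mul, one_mul, add_comm, hmq,
        Finsupp.filter_add_filter_not, C_mul_monomial, mul_one]
    by_cases hT : ∀ u, mq u ≤ T
    · let a : Idx d T := fun uq => ⟨mq uq.1, Nat.lt_succ_of_le (hT _)⟩
      have ha : toExp a = mq := by
        ext u
        rw [toExp_apply]
        split_ifs with h
        · rfl
        · rw [hmq, Finsupp.filter_apply, if_neg h]
      refine ⟨Pi.single (Fintype.equivFin (Idx d T) a) (Ideal.Quotient.mk _ (C r * monomial mz 1)), ?_⟩
      rw [phi_single, psi_mk, wgen, ha, hsplit, map_mul (rename zvar), rename_C, ← map_mul]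
    · push Not at hT
      obtain ⟨u, hu⟩ := hT
      refine ⟨0, ?_⟩
      have h0 : phi T (0 : Fin (Fintype.card (Idx d T)) → Rt d (T + 1)) = 0 := by
        unfold phi; simp
      rw [h0, eq_comm, Ideal.Quotient.eq_zero_iff_mem, hsplit]
      refine Ideal.mul_mem_left _ _ (mem_truncIdeal_iff.mpr ((wtGe_monomial mq 1).mono ?_))
      have := Finsupp.le_weight Var.wt (s := u) (by have := u.one_le_wt; omega) mq
      have h1 := u.one_le_wt
      calc T + 1 ≤ mq u := hu
        _ ≤ Finsupp.weight Var.wt mq := this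

/-- The matrix of `π_T(c)` on the generators (a lift through `phi`). -/
def rho (T K : ℕ) (c : Matrix (Fin d) (Fin d) ℂ) :
    Matrix (Fin (Fintype.card (Idx d T))) (Fin (Fintype.card (Idx d T))) (Rt d (T + 1)) :=
  fun i b => Classical.choose (phi_surj T (Eprod K c * sigma c (monomial (toExp ((Fintype.equivFin (Idx d T)).symm b)) 1))) i

/-- The columns of `ρ(c)` parametrise the images of the generators. -/
theorem phi_rho_col (T K : ℕ) (hK : T + 1 ≤ K) (c : Matrix (Fin d) (Fin d) ℂ) (b : Fin (Fintype.card (Idx d T))) :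
    phi T (fun i => rho T K c i b) = piT T c (wgen T ((Fintype.equivFin (Idx d T)).symm b)) := by
  unfold rho wgen
  rw [piT_mk hK]
  exact Classical.choose_spec (phi_surj T (Eprod K c * sigma c (monomial (toExp ((Fintype.equivFin (Idx d T)).symm b)) 1)))

/-- `π_T(c)` is linear over the image of `R_t` (finite sums). -/
theorem piT_sum_psi_mul (T : ℕ) (c : Matrix (Fin d) (Fin d) ℂ) {ι : Type*} (s : Finset ι)
    (x : ι → Rt d (T + 1)) (w : ι → TruncModel d ℂ T) :
    piT T c (∑ i ∈ s, psi d T (x i) * w i) = ∑ i ∈ s, psi d T (x i) * piT T c (w i) := by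
  classical
  induction s using Finset.induction_on with
  | empty => simp [piT]
  | insert b s hb ih => rw [Finset.sum_insert hb, Finset.sum_insert hb, piT_add, piT_psi_mul, ih]

/-- **Lift property**: `phi (ρ(c) v) = π_T(c) (phi v)`. -/
theorem phi_mulVec (T K : ℕ) (hK : T + 1 ≤ K) (c : Matrix (Fin d) (Fin d) ℂ)
    (v : Fin (Fintype.card (Idx d T)) → Rt d (T + 1)) :
    phi T ((rho T K c).mulVec v) = piT T c (phi T v) := by
  classical
  have e1 : phi T ((rho T K c).mulVec v) =
      ∑ b : Fin (Fintype.card (Idx d T)), psi d T (v b) * phi T (fun i => rho T K c i b) := by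
    unfold phi
    simp only [Matrix.mulVec, dotProduct, map_sum, map_mul, Finset.sum_mul, Finset.mul_sum]
    rw [Finset.sum_comm]
    refine Finset.sum_congr rfl fun b _ => Finset.sum_congr rfl fun a _ => ?_
    ring
  rw [e1]
  simp_rw [phi_rho_col T K hK]
  unfold phi
  rw [piT_sum_psi_mul]
  exact (Fintype.sum_equiv (Fintype.equivFin (Idx d T)) _ _ fun a => by simp).symm

/-- Landing hook of part 10: the lift property. -/
theorem stub_pm_lift : ∀ (d T K : ℕ), T + 1 ≤ K → ∀ (c : Matrix (Fin d) (Fin d) ℂ) (v : Fin (Fintype.card (Idx d T)) → Rt d (T + 1)), phi T ((rho T K c).mulVec v) = piT T c (phi T v) :=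
  fun _ T K hK c v => phi_mulVec T K hK c v

end Summit.MatrixMultiplication.MatrixMultiplication.Theorems.UnitriangularCostShape.ProductModel
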